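import Summits.CriticalPhenomena.PercolationContinuityZ3.Theorems.Transplant.BoxProdZ2ConcFaceRouteTube
import Summits.CriticalPhenomena.PercolationContinuityZ3.Theorems.Transplant.BoxProdZ2ConcFaceRouteGeom
import HarnessLib

/-!
# The ELONGATED DEEP ROUTE of a face-step contact (design (D), §11 v2; residue (F), `advRoute_of_contact` part 4c = the `∃ γ Qt Ft` clause of
# `hroute` in `BoxProdZ2ConcFace`): Kozma–Nitzan's Lemma 11 in the product — from the contact's wired kit prism a first hop of scale `ℓ1`
# lands on a row, then a rooted straight run of `nA + 1 ≤ nmax + 1` target steps (advance `s₁`) inside the inner tube `B_X(c, L_A)` climbs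
# through the fresh rows `farA` to a face inside `B(w₀, Rt) × M(x + du)`; the chain is transferred to the link event under the face law by
# p2-g2's `lt_real_of_advRChain` with p3's providers (route law, kits `kitClauseQ`/`hcon_tube`/`roomR`, rim excess from the wired source, first hop)

builds on p205010 (kernel theorem, internal audit signed; external expert review pending) — nothing in this file uses p205010.
Lane `prim-bschramm`, seat `prim-bschramm-p3` (residue (F) of V56, arbitration 16:02Z); helper file (`--supports stmt-CriticalPhenomena-4575`).

* `innerRunOK_contact` — the per-contact parameters (`ca = lv + ℓ1`, `cb = b`, `q' = ℓ1`, `nA = ⌊(17r - ca)⁺ / s₁⌋`) are admissible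
  (`InnerRunOK`, `nA ≤ nmax`, the first-hop square inside `farA`, separation from the kit cube) under CONSTANT inequalities;
* **`route_of_contact`** — for a weighting `Wt` vanishing off the edges that is a subbox of the tube graph over `B(w₀, R)` on every region inside
  `B(w₀, R) × farA`, a deep contact of a face-step level has a route: `∃ γ Qt Ft, γ c ∈ V₀ ∧ Ft ⊆ B(w₀, Rt) × M(x+du) ∧ Qt ⊆ B(w₀, R) × farA ∧
  Ft ∩ kitCube = ∅ ∧ 1 - δ₂² < P_{Wt}(linkIn Qt (kit prism) Ft)`.
[cite: KozmaNitzan2024, §4 Lemma 11 (pp. 22–23), Lemma 12 (p. 24), p. 30 (Step III)]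
-/

noncomputable section

open MeasureTheory

namespace Summit.CriticalPhenomena.PercolationContinuityZ3.Theorems

namespace Transplant

namespace BoxProdZ2

open Literature.Probability.Percolation Literature.Probability.LatticeModels SimpleGraph KNLevels
open Literature.Probability.Percolation.KozmaNitzan
open Literature.Probability.Percolation.KozmaNitzan.Cells (oth oth_ne eq_oth_of_ne sgOf sgOf_sign)
open Literature.Probability.Percolation.GM
open Literature.Barriers.CriticalPhenomena (graphBall graphBall_finite mem_graphBall_self graphBall_mono)
open ChainPlanar

variable {W : Type} [DecidableEq W] (X : SimpleGraph W) [X.LocallyFinite]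

/-! ## §1 The per-contact parameters -/

/-- **The per-contact parameters of the inner run are admissible under constant inequalities.**  For a contact whose cube centre has
signed level `lv ∈ [5r + 10s(j+1) - Rlev, 5r + 10s(j+1) + Rlev]` and transverse offset `|b| ≤ 2r + Rlev`: with `ca = lv + ℓ1`,
`nA = ⌊(17r - ca)⁺ / s₁⌋`, the inner run `InnerRunOK C j s₁ R' ℓ₀ nA ca b ℓ1` is admissible, `nA ≤ nmax`, the first-hop square
`v + Λ_{ℓ1}` lies in the rows of `farA`, and the rooted regions start above the kit cube (`lv + M < ca - (s₁ + 2R')`).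
[cite: KozmaNitzan2024, §4 Lemma 11 (pp. 22–23), p. 30 (Step III)] -/
theorem innerRunOK_contact (C : PCells) {j : ℕ} (hjK : j + 1 ≤ C.K) {s₁ R' ℓ₀ ℓ1 Rlev M nmax : ℕ} (hMℓ : M < ℓ₀)
    (hs : R' + ℓ₀ ≤ s₁) (hs2 : 2 * R' ≤ s₁) (hℓ1 : M + s₁ + 2 * R' + 1 ≤ ℓ1) (hn : 12 * C.r ≤ nmax * s₁)
    (hbig : Rlev + ℓ1 + 2 * s₁ + (nmax + 3) * R' ≤ C.r) (h10s : Rlev + ℓ1 + 1 ≤ 10 * C.s) {lv b : ℤ}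
    (hlv1 : 5 * (C.r : ℤ) + 10 * C.s * (j + 1 : ℕ) - Rlev ≤ lv) (hlv2 : lv ≤ 5 * (C.r : ℤ) + 10 * C.s * (j + 1 : ℕ) + Rlev)
    (hb : |b| ≤ 2 * (C.r : ℤ) + Rlev) :
    let ca : ℤ := lv + ℓ1
    let nA : ℕ := (17 * (C.r : ℤ) - ca).toNat / s₁
    InnerRunOK C j (s₁ : ℤ) R' ℓ₀ nA ca b (ℓ1 : ℤ) ∧ nA ≤ nmax ∧
      (5 * (C.r : ℤ) + 10 * C.s * j + 1 ≤ lv - ℓ1 ∧ lv + ℓ1 ≤ 25 * (C.r : ℤ) ∧ -(5 * (C.r : ℤ)) ≤ b - ℓ1 ∧ b + ℓ1 ≤ 5 * (C.r : ℤ)) ∧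
      lv + M < ca - ((s₁ : ℤ) + 2 * R') := by
  intro ca nA
  -- linear bookkeeping (all in `ℤ`)
  have hsj : (C.s : ℤ) * j + C.s ≤ C.r := by
    have h := Nat.mul_le_mul_left C.s hjK
    rw [Nat.mul_comm C.s C.K] at h
    have : ((C.s * (j + 1) : ℕ) : ℤ) ≤ C.r := by exact_mod_cast (show C.s * (j + 1) ≤ C.r from h)
    push_cast at this; linarith
  have hsj0 : 0 ≤ (C.s : ℤ) * j := by positivity
  have e1 : 10 * (C.s : ℤ) * ((j + 1 : ℕ) : ℤ) = 10 * ((C.s : ℤ) * j) + 10 * C.s := by push_cast; ring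
  rw [e1] at hlv1 hlv2
  have hs1 : 1 ≤ s₁ := by omega
  have hs0 : 0 < s₁ := hs1
  have hbig' : (Rlev : ℤ) + ℓ1 + 2 * s₁ + (nmax * R' + 3 * R') ≤ C.r := by
    have : ((Rlev + ℓ1 + 2 * s₁ + (nmax + 3) * R' : ℕ) : ℤ) ≤ C.r := by exact_mod_cast hbig
    push_cast at this; linarith
  have h10s' : (Rlev : ℤ) + ℓ1 + 1 ≤ 10 * C.s := by exact_mod_cast h10s
  have hℓ1' : (M : ℤ) + s₁ + 2 * R' + 1 ≤ ℓ1 := by exact_mod_cast hℓ1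
  have hs' : (R' : ℤ) + ℓ₀ ≤ s₁ := by exact_mod_cast hs
  have hs2' : 2 * (R' : ℤ) ≤ s₁ := by exact_mod_cast hs2
  have hn' : 12 * (C.r : ℤ) ≤ nmax * s₁ := by exact_mod_cast hn
  have hR0 : (0 : ℤ) ≤ R' := by positivity
  have hnR0 : (0 : ℤ) ≤ (nmax : ℤ) * R' := by positivity
  have hbabs := le_abs_self b
  have hbabs' := neg_abs_le b
  have hca5 : 5 * (C.r : ℤ) ≤ ca := by change _ ≤ lv + ℓ1; linarith
  have hca15 : ca ≤ 15 * (C.r : ℤ) + Rlev + ℓ1 := by change lv + ℓ1 ≤ _; linarith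
  -- the number of advance steps
  set d : ℕ := (17 * (C.r : ℤ) - ca).toNat with hd
  have hd1 : 17 * (C.r : ℤ) - ca ≤ d := Int.self_le_toNat _
  have hd2 : (d : ℤ) = max (17 * (C.r : ℤ) - ca) 0 := Int.toNat_eq_max _
  have hnA1 : ((nA * s₁ : ℕ) : ℤ) ≤ d := by exact_mod_cast Nat.div_mul_le_self d s₁
  have hnA2 : (d : ℤ) < ((nA * s₁ + s₁ : ℕ) : ℤ) := by exact_mod_cast Nat.lt_div_mul_add hs0
  push_cast at hnA1 hnA2
  have hd12 : (d : ℤ) ≤ 12 * C.r := by rw [hd2]; exact max_le (by linarith) (by positivity)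
  have hdca : ca + (d : ℤ) ≤ 17 * C.r + Rlev + ℓ1 := by
    rw [hd2]; have : max (17 * (C.r : ℤ) - ca) 0 ≤ 17 * C.r + Rlev + ℓ1 - ca := max_le (by linarith) (by linarith)
    linarith
  have hnAmax : nA ≤ nmax := by
    have h1 : (nA : ℤ) * s₁ ≤ nmax * s₁ := by linarith
    have h2 : (nA : ℤ) ≤ nmax := le_of_mul_le_mul_right h1 (by exact_mod_cast hs0)
    exact_mod_cast h2
  have hnR : (nA : ℤ) * R' ≤ nmax * R' := mul_le_mul_of_nonneg_right (by exact_mod_cast hnAmax) hR0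
  refine ⟨⟨by positivity, hs', hs2', ?_, ?_, ?_, ?_, ?_⟩, hnAmax, ⟨by linarith, by linarith, by linarith, by linarith⟩, ?_⟩
  · -- region `0` above the stub
    change _ ≤ lv + ℓ1; linarith
  · -- the far face at least at `17 r`
    have : ca + ((nA : ℤ) + 1) * s₁ = ca + (nA * s₁ + s₁) := by ring
    rw [this]; linarith
  · -- the far face at most at `23 r`
    have : ca + ((nA : ℤ) + 1) * s₁ = ca + (nA * s₁ + s₁) := by ring
    rw [this]; linarith
  · -- the regions inside `farA` transversally
    have : |b| + (ℓ1 : ℤ) + 2 * s₁ + ((nA : ℤ) + 3) * R' = |b| + ℓ1 + 2 * s₁ + (nA * R' + 3 * R') := by ring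
    rw [this]; linarith
  · -- the far face inside `M(x+du)` transversally
    have : |b| + (ℓ1 : ℤ) + s₁ + ((nA : ℤ) + 2) * R' = |b| + ℓ1 + s₁ + (nA * R' + 2 * R') := by ring
    rw [this]; linarith
  · change lv + M < lv + ℓ1 - _; linarith

/-! ## §2 The kits and the rim excess of the inner run under the route law -/

section Inner

variable [Countable W] {c : W} {L_A L'A : ℕ} {C : PCells} {x : Site 2} {du : MDir} {j s₁ R' ℓ₀ nA ℓ1 RlevA N_A M : ℕ} {ca cb : ℤ}
  {v : Site 2} {Qt : Finset (W × Site 2)}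

/-- **The kit clauses of the inner run** (every rooted step `k ≤ nA`, every level `jj ∈ [M+1, RlevA]`) under any weighting `W'` that is a subbox
of the inner tube graph on the rooted regions: `kitClauseQ` with the dichotomy `hcon_tube` (tube `B(c, L_A)`, rim width `L'_A`), the rooms from
`roomR` (route scales `ℓ ∈ [ℓ₀, ℓ₁A]`, `ℓ₁A ≥ s₁ + R'`). [cite: KozmaNitzan2024, §4 Lemma 10 (pp. 17–21), Lemma 11 (pp. 22–23)] -/
theorem innerKits (hOK : InnerRunOK C j (s₁ : ℤ) R' ℓ₀ nA ca cb (ℓ1 : ℤ)) (hRl : RlevA + 1 ≤ R')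
    {Δ : ℕ} (hΔ : ∀ w, X.degree w ≤ Δ) {p₀ : unitInterval} (hT : TubeSubcritical X p₀) {q : unitInterval} (V₀ : Finset W)
    (hfr : ∀ w : W, ∃ γ : X ≃g X, γ w ∈ V₀) {δ : ℝ} (hδ : 0 < δ) {msel : W → ℕ} (hmsel : ∀ τ ∈ V₀, msel τ ≤ M)
    (hstd : ∀ τ ∈ V₀,
      1 - δ ^ 2 < (bondPercolation (X □ zdGraph 2) q).real (UniqZone.zone (X □ zdGraph 2) (ufatSeq X hT V₀ τ) (msel τ) M) ∧
      ∀ g : HOct 2, 1 - δ ^ 2 < (bondPercolation (X □ zdGraph 2) q).real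
        (linkIn (↑(ufatSeq X hT V₀ τ M)) (ufatSeq X hT V₀ τ (msel τ)) (ballFin X τ (ufatRadius X hT V₀ M) ×ˢ piece g M)))
    (hMℓ : M < ℓ₀) {ℓ₁A : ℕ}
    (hlink : ∀ ℓ, ℓ₀ ≤ ℓ → ℓ ≤ ℓ₁A → ∀ τ ∈ V₀, ∀ g : HOct 2, 1 - δ ^ 2 < (bondPercolation (X □ zdGraph 2) q).real
      (linkIn (↑(ufatSeq X hT V₀ τ ℓ)) (ufatSeq X hT V₀ τ (msel τ)) (ballFin X τ (ufatRadius X hT V₀ ℓ) ×ˢ piece g ℓ)))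
    (hLψ : ufatRadius X hT V₀ ℓ₁A + ufatRadius X hT V₀ M ≤ L'A) (hLR : L'A ≤ L_A) (hsA : s₁ + R' ≤ ℓ₁A)
    (kk : ℕ) (hN : kk * kitB Δ M (ufatRadius X hT V₀ M) ≤ N_A) (hkk : (1 - (q : ℝ) ^ kitSB Δ M (ufatRadius X hT V₀ M)) ^ kk ≤ δ)
    {W' : Sym2 (W × Site 2) → unitInterval}
    (hsub : ∀ k ≤ nA, IsSubbox (tubeGraph X (ballFin X c L_A)) W' q
      ((innerTAD X c L_A L'A C x du ca cb ℓ1 s₁ R' ℓ₀ nA RlevA N_A (M + 1) RlevA (c, v) Qt).stepDR k)) :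
    let P := innerTAD X c L_A L'A C x du ca cb ℓ1 s₁ R' ℓ₀ nA RlevA N_A (M + 1) RlevA (c, v) Qt
    ∀ k ≤ P.nA, ∀ jj ∈ Finset.Icc P.j₀ P.j₁, ∃ (σ : SData (W × Site 2)) (Sz : Finset (W × Site 2)),
      SHyp (tubeLData X P.π (P.alo k) (P.ahi k) P.root P.Sfin) jj σ ∧ σ.N ≤ P.N ∧
      (1 - (q : ℝ) ^ σ.sB) ^ σ.k ≤ δ ∧ Sz ⊆ (tubeLData X P.π (P.alo k) (P.ahi k) P.root P.Sfin).X jj ∧ Sz ⊆ P.stepDR k ∧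
      (∀ y ∈ σ.K, ∀ e ∈ σ.seed y, e ∉ wireSet (↑Sz : Set (W × Site 2))) ∧ (∀ y ∈ σ.K, σ.face y ⊆ Sz) ∧
      (∀ y ∈ σ.K, 1 - 3 * δ ≤ (prodBernoulli W').real {ω | ∃ u ∈ σ.face y,
        1 - δ < (prodBernoulli (pinW W' (wireSet (↑Sz : Set (W × Site 2))) ω)).real
          (⋃ t ∈ P.coreE k, openConnIn (↑(P.stepDR k) : Set (W × Site 2)) u t)}) := by
  intro P k hk jj hjj
  have hj₁ : jj ≤ RlevA := (Finset.mem_Icc.1 hjj).2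
  have hjM : M + 1 ≤ jj := (Finset.mem_Icc.1 hjj).1
  have hk' : k ≤ nA := hk
  have hwide : ∀ i, (P.alo k - ((jj : ℕ) : Site 2)) i + 2 * M + 2 ≤ (P.ahi k + ((jj : ℕ) : Site 2)) i :=
    innerTAD_wide X (c := c) (L_A := L_A) (L'A := L'A) (Rlev := RlevA) (N := N_A) (j₀ := M + 1) (j₁ := RlevA) (o := (c, v)) (Sfin := Qt)
      hOK k hjM
  have hWD : IsSubbox (tubeGraph X (ballFin X c L_A)) W' q (ballFin X c L_A ×ˢ P.aregionR k) := hsub k hk'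
  have hXD : tubeLevel (ballFin X c L_A) (P.alo k) (P.ahi k) jj ⊆ ballFin X c L_A ×ˢ P.aregionR k :=
    innerTAD_level_subset X (c := c) (L_A := L_A) (L'A := L'A) (Rlev := RlevA) (N := N_A) (j₀ := M + 1) (j₁ := RlevA) (o := (c, v)) (Sfin := Qt)
      hOK hRl hk' (by omega)
  have hnF : ufatRadius X hT V₀ M ≤ L_A := le_trans (Nat.le_add_left _ _) (hLψ.trans hLR)
  have hTpl : ballFin X c L_A ×ˢ P.acore (k + 1) ⊆ P.coreE k := Finset.subset_union_left
  have hRimT : P.Rim k ⊆ P.coreE k := Finset.subset_union_right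
  have hRim : (ballFin X c L_A \ ballFin X c (L_A - L'A)) ×ˢ P.aregionR k ⊆ P.Rim k := fun _ h => h
  refine kitClauseQ X hΔ hT V₀ hδ hmsel hstd hnF hwide kk P.root P.Sfin hWD hXD hN hkk fun y hy => ?_
  -- the planar room at the contact's cube centre: a route scale `ℓ ∈ [ℓ₀, ℓ₁A]`
  obtain ⟨ℓ, hℓ₀, hℓ₁, hroomD, a, τ', hroomT⟩ := TubeAdvData.roomR P (sgOf_sign du) (innerRun_advOK hOK) hRl le_rfl (ℓ₁ := ℓ₁A)
    (by change 2 * (0 : ℤ) + (s₁ : ℤ) + (R' : ℤ) ≤ ℓ₁A; push_cast; linarith [(by exact_mod_cast hsA : (s₁ : ℤ) + R' ≤ ℓ₁A)])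
    hk' jj hj₁ _ (vctr_mem_level X hwide hy)
  have hψ : ufatRadius X hT V₀ ℓ + ufatRadius X hT V₀ M ≤ L'A := (Nat.add_le_add_right (ufatRadius_mono X hT V₀ hℓ₁) _).trans hLψ
  exact hcon_tube X hT V₀ hfr (lt_of_lt_of_le hMℓ hℓ₀) (hlink ℓ hℓ₀ hℓ₁) hnF hψ hLR hwide hWD hXD hTpl hRimT hRim hy hroomD hroomT

/-- **The rim excess of every rooted step is `≤ η`** under the route law, from the excess radius at the running parameter (sources at fibre
radius `ψ M` around the representatives, planar box `25 r`), `R₁ ≤ L_A - L'_A`, a frame `γ c ∈ V₀`, the route world inside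
`B(w₀, R) × farA` on which `Wt` is a subbox, and the separation of the regions from the kit prism. [cite: KozmaNitzan2024, §4 Lemma 12 (p. 24)]
[cite: MartineauSevero2019, Cor. 2.2] -/
theorem innerExc (hOK : InnerRunOK C j (s₁ : ℤ) R' ℓ₀ nA ca cb (ℓ1 : ℤ)) {w₀ : W} {R : ℕ} (hπ : ballFin X c L_A ⊆ ballFin X w₀ R)
    (h1 : 5 * (C.r : ℤ) + 10 * C.s * j + 1 ≤ sgOf du * (v du.1 - C.cen x du.1) - ℓ1)
    (h2 : sgOf du * (v du.1 - C.cen x du.1) + ℓ1 ≤ 25 * (C.r : ℤ))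
    (h3 : C.cen x (oth du.1) - 5 * (C.r : ℤ) ≤ v (oth du.1) - ℓ1) (h4 : v (oth du.1) + ℓ1 ≤ C.cen x (oth du.1) + 5 * (C.r : ℤ))
    {Wt : Sym2 (W × Site 2) → unitInterval} {q : unitInterval}
    (hWsub : ∀ Dd, Dd ⊆ ballFin X w₀ R ×ˢ C.farA x du j → IsSubbox (tubeGraph X (ballFin X w₀ R)) Wt q Dd)
    {p₀ : unitInterval} (hT : TubeSubcritical X p₀) (V₀ : Finset W) {msel : W → ℕ} (hmsel : ∀ τ ∈ V₀, msel τ ≤ M) (hMℓ1 : M < ℓ1)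
    (hψ1 : ufatRadius X hT V₀ ℓ1 ≤ L_A) (γ : X ≃g X) (hγ : γ c ∈ V₀) {η : ℝ} {R₁ : ℕ}
    (hR₁ : ∀ R'', R₁ ≤ R'' → ∀ τ ∈ V₀, ∀ (Rw : ℕ) (D' A' : Finset (W × Site 2)), D' ⊆ ballFin X τ Rw ×ˢ box 2 (25 * C.r) → A' ⊆ D' →
      (∀ a ∈ A', a.1 ∈ ballFin X τ (ufatRadius X hT V₀ M)) → (bondPercolation (X □ zdGraph 2) q).real (excess X τ R'' D' A') ≤ η)
    (hR₁L : R₁ ≤ L_A - L'A) (hsep : sgOf du * (v du.1 - C.cen x du.1) + M < ca - ((s₁ : ℤ) + 2 * R')) :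
    let Qt := innerQt X c L_A C x du s₁ R' nA ca cb ℓ1 v ℓ1
    let P := innerTAD X c L_A L'A C x du ca cb ℓ1 s₁ R' ℓ₀ nA RlevA N_A (M + 1) RlevA (c, v) Qt
    ∀ k ≤ nA, (prodBernoulli (routeW X Wt Qt (frameSeq X hT V₀ γ v (γ c) (msel (γ c))))).real
      (⋃ t ∈ P.Rim k, openConn ((c, v) : W × Site 2) t) ≤ η := by
  intro Qt P k hk
  set S := frameSeq X hT V₀ γ v (γ c) (msel (γ c)) with hS
  have hmM : msel (γ c) ≤ M := hmsel _ hγ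
  have hQt : Qt ⊆ ballFin X w₀ R ×ˢ C.farA x du j := innerQt_subset_prod_farA X hπ hOK h1 h2 h3 h4
  have hSprod : S = ballFin X c (ufatRadius X hT V₀ (msel (γ c))) ×ˢ (box 2 (msel (γ c))).image (fun t => t + v) :=
    frameSeq_eq_product X hT V₀ γ v c _
  have hS1 : S ⊆ frameSeq X hT V₀ γ v (γ c) ℓ1 := frameSeq_mono X hT V₀ γ v (γ c) (hmM.trans hMℓ1.le)
  have h1Q : frameSeq X hT V₀ γ v (γ c) ℓ1 ⊆ Qt := by
    rw [frameSeq_eq_product]; exact prod_shift_box_subset_innerQt X (ballFin_mono X c hψ1) ℓ1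
  have hSQ : S ⊆ Qt := hS1.trans h1Q
  have hRimD : P.Rim k ⊆ P.stepDR k := innerTAD_Rim_subset X k
  have hDQ : P.stepDR k ⊆ Qt := stepDR_subset_innerQt X hk v ℓ1
  have hSD : Disjoint S (P.stepDR k) := by
    rw [hSprod]; exact disjoint_prod_shift_box_stepDR X hOK hk (by linarith) _
  refine real_rim_le_of_wired_source X (hWsub Qt hQt) (fun u hu => hπ (innerQt_fst X hu)) hSQ (hRimD.trans hDQ)
    (hSD.mono_right hRimD) (center_mem_frameSeq X hT V₀ γ _) (c := c) (r₁ := L_A - L'A) (R₀' := ufatRadius X hT V₀ M)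
    (fun t ht => (Finset.mem_sdiff.1 (Finset.mem_product.1 ht).1).2) (fun s hs => ?_) V₀ hR₁ hR₁L γ hγ (Rw := L_A) (v := C.cen x)
    (Finset.product_subset_product le_rfl (innerQtPl_subset_box_image hOK h1 h2 h3 h4)) (coe_edgesIn_subset_wireSet X S) _
  rw [hSprod] at hs
  exact ballFin_mono X c (ufatRadius_mono X hT V₀ hmM) (Finset.mem_product.1 hs).1

end Inner

/-! ## §3 The route of a deep contact -/

/-- **THE ELONGATED DEEP ROUTE OF A FACE-STEP CONTACT** (Kozma–Nitzan's Lemma 11 in the product, the `∃ γ Qt Ft` clause of `hroute`).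
Setting: the tube `B(w₀, R)` of the face step `(x, du, j)` (`j + 1 ≤ K`), a weighting `Wt` vanishing off the edges of `X □ ℤ²` that is a subbox
of the tube graph on every region inside `B(w₀, R) × farA`; the inputs at the running parameter `q` at accuracy `δA²` (kit scale `M`, route scales
`[ℓ₀, ℓ₁A]`), frames, the inner counts at `δA`, the chain property of every length `≤ nmax + 1` at `(δA ↦ δ₂²)`, an excess radius `R₁A ≤ L_A - L'_A`
for sources at fibre radius `ψ M`, and the constant inequalities of `innerRunOK_contact`; a contact `x'` of the level `j' ∈ [M+1, Rlev]` of the face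
row whose retracted centre `c` is DEEP (`B(c, L_A) ⊆ B(w₀, Rt)`, `Rt ≤ R`).  Conclusion: a frame `γ` (`γ c ∈ V₀`), a route world
`Qt ⊆ B(w₀, R) × farA` and a far face `Ft ⊆ B(w₀, Rt) × M(x + du)` off the kit cube with `1 - δ₂² < P_{Wt}(linkIn Qt (kit prism) Ft)`.
[cite: KozmaNitzan2024, §4 Lemma 11 (pp. 22–23), Lemma 12 (p. 24), p. 30 (Step III)] -/
theorem route_of_contact [Countable W] (C : PCells) {x : Site 2} {du : MDir} {j : ℕ} (hjK : j + 1 ≤ C.K) {w₀ : W} {R Rt : ℕ} (hRt : Rt ≤ R)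
    {Wt : Sym2 (W × Site 2) → unitInterval} {q : unitInterval}
    (hWsub : ∀ Dd, Dd ⊆ ballFin X w₀ R ×ˢ C.farA x du j → IsSubbox (tubeGraph X (ballFin X w₀ R)) Wt q Dd)
    (hWG : ∀ e, e ∉ (X □ zdGraph 2).edgeSet → Wt e = 0)
    {Δ Δ' : ℕ} (hΔ : ∀ w, X.degree w ≤ Δ) {p₀ : unitInterval} (hT : TubeSubcritical X p₀) (V₀ : Finset W)
    (hfr : ∀ w : W, ∃ γ : X ≃g X, γ w ∈ V₀) {δ₂ δA : ℝ} (hδA : 0 < δA) (hδA1 : δA ≤ 1) {msel : W → ℕ} {M : ℕ}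
    (hmsel : ∀ τ ∈ V₀, msel τ ≤ M)
    (hstdA : ∀ τ ∈ V₀,
      1 - δA ^ 2 < (bondPercolation (X □ zdGraph 2) q).real (UniqZone.zone (X □ zdGraph 2) (ufatSeq X hT V₀ τ) (msel τ) M) ∧
      ∀ g : HOct 2, 1 - δA ^ 2 < (bondPercolation (X □ zdGraph 2) q).real
        (linkIn (↑(ufatSeq X hT V₀ τ M)) (ufatSeq X hT V₀ τ (msel τ)) (ballFin X τ (ufatRadius X hT V₀ M) ×ˢ piece g M)))
    {ℓ₀ ℓ₁A : ℕ} (hMℓ : M < ℓ₀)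
    (hlinkA : ∀ ℓ, ℓ₀ ≤ ℓ → ℓ ≤ ℓ₁A → ∀ τ ∈ V₀, ∀ g : HOct 2, 1 - δA ^ 2 < (bondPercolation (X □ zdGraph 2) q).real
      (linkIn (↑(ufatSeq X hT V₀ τ ℓ)) (ufatSeq X hT V₀ τ (msel τ)) (ballFin X τ (ufatRadius X hT V₀ ℓ) ×ˢ piece g ℓ)))
    {nmax : ℕ}
    (hchainA : ∀ n, n ≤ nmax → ∀ (π : Finset W) (Wg : Sym2 (W × Site 2) → unitInterval) (s : Fin (n + 1) → TStep (tubeGraph X π))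
      (T' : Fin (n + 1) → Finset (W × Site 2)) (η : ℝ),
      (∀ i, (s i).L.o = (s 0).L.o) → (∀ i : Fin n, T' (Fin.castSucc i) ⊆ (s i.succ).L.X 0) → (∀ i, T' i ⊆ (s i).T) →
      (∀ i, (s i).KitsAt Wg q Δ' δA) → η ≤ δA / 2 →
      (∀ i, (prodBernoulli Wg).real (⋃ t ∈ (s i).T \ T' i, openConn (s 0).L.o t) ≤ η) →
      1 - δA < (prodBernoulli Wg).real (s 0).L.reachB →
        1 - δ₂ ^ 2 < (prodBernoulli Wg).real (⋃ t ∈ T' (Fin.last n), openConn (s 0).L.o t))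
    {L_A L'A s₁ R' RlevA kkA N_A ℓ1 Rlev : ℕ}
    (hLψ : ufatRadius X hT V₀ ℓ₁A + ufatRadius X hT V₀ M ≤ L'A) (hLR : L'A ≤ L_A) (hRl : RlevA + 1 ≤ R')
    (hs : R' + ℓ₀ ≤ s₁) (hs2 : 2 * R' ≤ s₁) (hℓ1 : M + s₁ + 2 * R' + 1 ≤ ℓ1) (hℓ1A : ℓ1 ≤ ℓ₁A) (hsA : s₁ + R' ≤ ℓ₁A)
    (hn : 12 * C.r ≤ nmax * s₁) (hbig : Rlev + ℓ1 + 2 * s₁ + (nmax + 3) * R' ≤ C.r) (h10s : Rlev + ℓ1 + 1 ≤ 10 * C.s)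
    (hN : kkA * kitB Δ M (ufatRadius X hT V₀ M) ≤ N_A) (hkk : (1 - (q : ℝ) ^ kitSB Δ M (ufatRadius X hT V₀ M)) ^ kkA ≤ δA)
    (hcount : 1 / (1 - (q : ℝ)) ^ (Δ' * N_A) ≤ δA * ((Finset.Icc (M + 1) RlevA).card : ℝ))
    {ηA : ℝ} (hη : ηA ≤ δA / 2) {R₁A : ℕ}
    (hR₁ : ∀ R'', R₁A ≤ R'' → ∀ τ ∈ V₀, ∀ (Rw : ℕ) (D' A' : Finset (W × Site 2)), D' ⊆ ballFin X τ Rw ×ˢ box 2 (25 * C.r) → A' ⊆ D' →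
      (∀ a ∈ A', a.1 ∈ ballFin X τ (ufatRadius X hT V₀ M)) → (bondPercolation (X □ zdGraph 2) q).real (excess X τ R'' D' A') ≤ ηA)
    (hR₁L : R₁A ≤ L_A - L'A)
    {j' : ℕ} (hj'0 : M + 1 ≤ j') (hj'1 : j' ≤ Rlev) {x' : W × Site 2}
    (hx' : x' ∈ outerBoundary (tubeGraph X (ballFin X w₀ R)) (tubeLevel (ballFin X w₀ R)
      (sLo du.1 (sgOf du) (C.cen x) (5 * C.r + 10 * C.s * (j + 1 : ℕ)) (5 * C.r + 10 * C.s * (j + 1 : ℕ)) (2 * C.r))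
      (sHi du.1 (sgOf du) (C.cen x) (5 * C.r + 10 * C.s * (j + 1 : ℕ)) (5 * C.r + 10 * C.s * (j + 1 : ℕ)) (2 * C.r)) j'))
    (hdeep : ballFin X (fibCtrT X w₀ R (ufatRadius X hT V₀ M) x'.1) L_A ⊆ ballFin X w₀ Rt) :
    let lo := sLo du.1 (sgOf du) (C.cen x) (5 * C.r + 10 * C.s * (j + 1 : ℕ)) (5 * C.r + 10 * C.s * (j + 1 : ℕ)) (2 * C.r)
    let hi := sHi du.1 (sgOf du) (C.cen x) (5 * C.r + 10 * C.s * (j + 1 : ℕ)) (5 * C.r + 10 * C.s * (j + 1 : ℕ)) (2 * C.r)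
    ∃ (γ : X ≃g X) (Qt Ft : Finset (W × Site 2)), γ (fibCtrT X w₀ R (ufatRadius X hT V₀ M) x'.1) ∈ V₀ ∧
      Ft ⊆ ballFin X w₀ Rt ×ˢ C.M (x + stepVec du) ∧ Qt ⊆ ballFin X w₀ R ×ˢ C.farA x du j ∧
      Disjoint Ft (kitCube X w₀ R (lo - ((j' : ℕ) : Site 2)) (hi + ((j' : ℕ) : Site 2)) M (ufatRadius X hT V₀ M) x') ∧
      1 - δ₂ ^ 2 < (prodBernoulli Wt).real (linkIn (↑Qt)
        (frameSeq X hT V₀ γ (vctr (lo - ((j' : ℕ) : Site 2)) (hi + ((j' : ℕ) : Site 2)) M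
          (pwin (lo - ((j' : ℕ) : Site 2)) (hi + ((j' : ℕ) : Site 2)) M x'.2).1
          (pwin (lo - ((j' : ℕ) : Site 2)) (hi + ((j' : ℕ) : Site 2)) M x'.2).2.1
          (pwin (lo - ((j' : ℕ) : Site 2)) (hi + ((j' : ℕ) : Site 2)) M x'.2).2.2)
          (γ (fibCtrT X w₀ R (ufatRadius X hT V₀ M) x'.1)) (msel (γ (fibCtrT X w₀ R (ufatRadius X hT V₀ M) x'.1)))) Ft) := by
  intro lo hi
  set c := fibCtrT X w₀ R (ufatRadius X hT V₀ M) x'.1 with hc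
  obtain ⟨γ, hγ⟩ := hfr c
  set v := vctr (lo - ((j' : ℕ) : Site 2)) (hi + ((j' : ℕ) : Site 2)) M (pwin (lo - ((j' : ℕ) : Site 2)) (hi + ((j' : ℕ) : Site 2)) M x'.2).1
    (pwin (lo - ((j' : ℕ) : Site 2)) (hi + ((j' : ℕ) : Site 2)) M x'.2).2.1 (pwin (lo - ((j' : ℕ) : Site 2)) (hi + ((j' : ℕ) : Site 2)) M x'.2).2.2
    with hv
  -- the planar position of the cube centre
  have hwide : ∀ k, (lo - ((j' : ℕ) : Site 2)) k + 2 * M + 2 ≤ (hi + ((j' : ℕ) : Site 2)) k := faceStep_hwide C hj'0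
  have hvmem : v ∈ Finset.Icc (lo - ((j' : ℕ) : Site 2)) (hi + ((j' : ℕ) : Site 2)) := vctr_mem_level X hwide hx'
  rw [sBox_enlarge _ _ (sgOf_sign du), PCells.mem_psBox_iff] at hvmem
  obtain ⟨⟨hlv1, hlv2⟩, hb1, hb2⟩ := hvmem
  have hjR : (j' : ℤ) ≤ Rlev := by exact_mod_cast hj'1
  obtain ⟨hOK, hnA, ⟨h1, h2, h3, h4⟩, hsep⟩ := innerRunOK_contact C hjK hMℓ hs hs2 hℓ1 hn hbig h10s
    (lv := sgOf du * (v du.1 - C.cen x du.1)) (b := v (oth du.1) - C.cen x (oth du.1)) (by linarith) (by linarith)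
    (abs_le.2 ⟨by linarith, by linarith⟩)
  set ca : ℤ := sgOf du * (v du.1 - C.cen x du.1) + ℓ1 with hca
  set nA : ℕ := (17 * (C.r : ℤ) - ca).toNat / s₁ with hnAdef
  have h3' : C.cen x (oth du.1) - 5 * (C.r : ℤ) ≤ v (oth du.1) - ℓ1 := by linarith
  have h4' : v (oth du.1) + ℓ1 ≤ C.cen x (oth du.1) + 5 * (C.r : ℤ) := by linarith
  set Qt := innerQt X c L_A C x du s₁ R' nA ca (v (oth du.1) - C.cen x (oth du.1)) ℓ1 v ℓ1 with hQt
  set P := innerTAD X c L_A L'A C x du ca (v (oth du.1) - C.cen x (oth du.1)) ℓ1 s₁ R' ℓ₀ nA RlevA N_A (M + 1) RlevA (c, v) Qt with hP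
  set S := frameSeq X hT V₀ γ v (γ c) (msel (γ c)) with hS
  have hπR : ballFin X c L_A ⊆ ballFin X w₀ R := hdeep.trans (ballFin_mono X w₀ hRt)
  have hmM : msel (γ c) ≤ M := hmsel _ hγ
  have hMℓ1 : M < ℓ1 := by omega
  have hψ1 : ufatRadius X hT V₀ ℓ1 ≤ L_A :=
    le_trans ((ufatRadius_mono X hT V₀ hℓ1A).trans ((Nat.le_add_right _ _).trans hLψ)) hLR
  have hQtsub : Qt ⊆ ballFin X w₀ R ×ˢ C.farA x du j := innerQt_subset_prod_farA X hπR hOK h1 h2 h3' h4'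
  have hSprod : S = ballFin X c (ufatRadius X hT V₀ (msel (γ c))) ×ˢ (box 2 (msel (γ c))).image (fun t => t + v) :=
    frameSeq_eq_product X hT V₀ γ v c _
  have h1Q : frameSeq X hT V₀ γ v (γ c) ℓ1 ⊆ Qt := by
    rw [frameSeq_eq_product]; exact prod_shift_box_subset_innerQt X (ballFin_mono X c hψ1) ℓ1
  have hSQ : S ⊆ Qt := (frameSeq_mono X hT V₀ γ v (γ c) (hmM.trans hMℓ1.le)).trans h1Q
  have hSD : ∀ k ≤ nA, Disjoint S (P.stepDR k) := fun k hk => by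
    rw [hSprod]; exact disjoint_prod_shift_box_stepDR X hOK hk (by linarith [(by exact_mod_cast hmM : (msel (γ c) : ℤ) ≤ M)]) _
  have hsub : ∀ k ≤ nA, IsSubbox (tubeGraph X (ballFin X c L_A)) (routeW X Wt Qt S) q (P.stepDR k) := fun k hk =>
    isSubbox_routeW X hπR hWG (stepDR_subset_innerQt X hk v ℓ1) (fun u hu => innerQt_fst X hu) (hSD k hk)
      (hWsub _ ((stepDR_subset_innerQt X hk v ℓ1).trans hQtsub))
  have hFtD : P.coreT nA ⊆ P.stepDR nA := coreT_last_subset_stepDR X hOK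
  have hSF : Disjoint S (P.coreT nA) := (hSD nA le_rfl).mono_right hFtD
  -- the landing face of the first hop
  obtain ⟨ua, hua⟩ := exists_unit_eq (sgOf_sign du)
  let τ' : Fin 2 → ℤˣ := fun i => if i = du.1 then ua else 1
  have hτ : (τ' du.1 : ℤ) = sgOf du := by simp [τ', hua]
  have hτ' : (τ' (oth du.1) : ℤ) = 1 := by simp [τ', oth_ne]
  have hB₀ : ballFin X c (ufatRadius X hT V₀ ℓ1) ×ˢ (orthantFace du.1 τ' ℓ1).image (fun t => t + v) ⊆
      ballFin X c L_A ×ˢ Adv.core 0 (ℓ1 : ℤ) (s₁ : ℤ) R' du.1 (sgOf du) (innerCtr C x du ca (v (oth du.1) - C.cen x (oth du.1))) 0 :=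
    fatFace_subset_core_zero X hτ hτ' rfl rfl rfl (ballFin_mono X c hψ1)
  refine ⟨γ, Qt, P.coreT nA, hγ, innerTAD_coreT_subset X hOK hdeep, hQtsub, ?_, ?_⟩
  · -- the far face is off the kit cube
    rw [← frameSeq_eq_kitCube X hT V₀ γ (τ := γ c) rfl, frameSeq_eq_product]
    exact (disjoint_prod_shift_box_stepDR X hOK le_rfl hsep _).symm.mono_left hFtD
  · -- the chain
    have hsrc : 1 - δA < (prodBernoulli (routeW X Wt Qt S)).real
        (⋃ t ∈ ballFin X c (ufatRadius X hT V₀ ℓ1) ×ˢ (orthantFace du.1 τ' ℓ1).image (fun t => t + v), openConn ((c, v) : W × Site 2) t) := by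
      have h := wired_prism_hsrc_of_le X hT V₀ (hlinkA ℓ1 (by omega) hℓ1A) γ hγ (hmM.trans hMℓ1.le) v
        (fun u hu u' hu' hadj => routeW_ge X (hWsub Qt hQtsub) (fun u hu => hπR (innerQt_fst X hu)) h1Q h1Q hu hu' hadj)
        (fun u hu u' hu' hadj => routeW_eq_one X hSQ hu hu' hadj) du.1 τ'
      have : 1 - δA ≤ 1 - δA ^ 2 := by nlinarith
      exact this.trans_lt h
    exact innerRoute_lt X hOK hRl le_rfl (p := q) (W' := routeW X Wt Qt S)
      (μA := (prodBernoulli Wt).real (linkIn (↑Qt : Set (W × Site 2)) S (P.coreT nA))) (Δ' := Δ') (δ := δA) (ε'' := δ₂ ^ 2) (η := ηA)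
      (hchainA nA hnA (ballFin X c L_A)) hsub (finSupp_routeW X Wt Qt S) (fun k hk => stepDR_subset_innerQt X hk v ℓ1)
      (fun k hk => root_not_mem_stepDR X hOK hk (by linarith)) (root_mem_innerQt X ℓ1) hcount
      (innerKits X hOK hRl hΔ hT V₀ hfr hδA hmsel hstdA hMℓ hlinkA hLψ hLR hsA kkA hN hkk hsub) hη
      (innerExc X hOK hπR h1 h2 h3' h4' hWsub hT V₀ hmsel hMℓ1 hψ1 γ hγ hR₁ hR₁L hsep) hB₀ hsrc
      (real_biUnion_openConn_routeW_le_linkIn X Wt hSQ hSF (center_mem_frameSeq X hT V₀ γ _))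

end BoxProdZ2

end Transplant

end Summit.CriticalPhenomena.PercolationContinuityZ3.Theorems

end
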